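import Summits.RiemannHypothesis.RiemannHypothesis.Theorems.WeilFormatCZetaTailGram
import HarnessLib

/-!
# Format C, design C∞: the `N`-uniform Gram majorant of an ARBITRARY finite family of tail sequences

Route context: Fourier–Galerkin / Schur-complement certificates of Weil positivity on a window ("format C";
cell memo `run/shared/lean/pub/rh-explicit/rh-explicit-weil-10/KERNEL-LEVER.md` §19–§20, sizing note
`run/shared/lean/pub/rh-explicit/rh-explicit-weil-2/gen9/CINF-DOOR-SIZING.md` §2–§3; supporting
stmt-RiemannHypothesis-0098; seat rh-explicit-weil-10).

`WeilFormatCDeflatedFarCouplingGram.coupling_majorant_gram` reduces the structured `Uq` tail of the C∞ door to ONE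
hypothesis: a Gram majorant `Σ_{m∈[B₃,N)} (Σ_f u_f φ_f(m))² ≤ Γ(u)` valid for every truncation `N`, for a finite set of
family functions `φ_f` (`f : Fin F`; for the C∞ rung: `{m^{−e}, m^{−e} log m} ⊗ {1, cos(mθ_p), sin(mθ_p)}` and the polar
pair).  This file produces `Γ` from ENTRY BOXES of the infinite Gram, for arbitrary families (generalising
`WeilFormatCZetaTailGram.sum_Ico_sq_sum_div_pow_le_gram`, the pure-power case, and `WeilFormatCMeanSquareGeneric`, one fixed-weight
prime sum):

* `familyGram_summable_mul` — `Σ_k φ_f(B₃+k)φ_{f'}(B₃+k)` is summable once the squares are;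
* `sum_Ico_sq_sum_mul_le_gram_tsum` — finite Gram below the infinite one (monotonicity):
  `Σ_{m∈Ico B₃ N} (Σ_f u_f φ_f(m))² ≤ Σ_f Σ_{f'} u_f u_{f'} Σ'_{k} φ_f(B₃+k)φ_{f'}(B₃+k)` for every `N`;
* `sum_Ico_sq_sum_mul_le_of_boxes` — with entry boxes `|Σ' φ_fφ_{f'} − Γmid(f,f')| ≤ ρ(f,f')` (`ρ` symmetric) and weights
  `ν > 0`: `≤ Σ_{f,f'} u_f u_{f'} Γmid(f,f') + Σ_f u_f² Σ_{f'} ρ(f,f') ν_{f'}/ν_f` (`gram_le_mid_add_gershgorin`);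
* bookkeeping for the data side's boxes: `tsum_shift_eq_sum_Ico_add_tsum_shift` (an entry = exact range `[B₃,B₄)` + tail from
  `B₄`), `abs_sub_add_le_of_boxes` (box of a sum), `abs_tsum_shift_le_of_partial` / `tsum_shift_le_of_partial` /
  `sum_Ico_le_tsum_shift` (turning the tree's finite-`N` tail lemmas — Abel bounds of `WeilFormatCTrigTailSums`, zeta tails —
  into bounds of the infinite tails).

Pure real analysis of series; standard axioms; no definitions; nothing Weil-specific; no RH claim.
-/

set_option autoImplicit false
-- `Summit.RiemannHypothesis.RiemannHypothesis.…` is the layout-mandated namespace (summit = problem name).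
set_option linter.dupNamespace false

noncomputable section

open Finset Filter
open scoped BigOperators Topology

namespace Summit.RiemannHypothesis.RiemannHypothesis.Theorems.WeilFormatC

/-! ## Summability of the Gram entries -/

/-- Products are summable once the squares are: `|ab| ≤ (a² + b²)/2`. -/
theorem familyGram_summable_mul {a b : ℕ → ℝ} (ha : Summable fun k ↦ a k ^ 2) (hb : Summable fun k ↦ b k ^ 2) :
    Summable fun k ↦ a k * b k := by
  have habs : Summable fun k ↦ |a k * b k| := by
    refine Summable.of_nonneg_of_le (fun k ↦ abs_nonneg _) (fun k ↦ ?_) ((ha.add hb).div_const 2)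
    rw [abs_mul]
    have h := two_mul_le_add_sq |a k| |b k|
    rw [sq_abs, sq_abs] at h
    linarith
  exact habs.of_abs

/-! ## Finite Gram below the infinite Gram -/

/-- **Finite Gram below the infinite one** (monotonicity in `N`): for family functions `φ_f` whose squares are summable on
`[B₃, ∞)`, every `N` and every coefficient vector `u`,
`Σ_{m∈Ico B₃ N} (Σ_f u_f φ_f(m))² ≤ Σ_f Σ_{f'} u_f u_{f'} · Σ'_k φ_f(B₃+k) φ_{f'}(B₃+k)`. -/
theorem sum_Ico_sq_sum_mul_le_gram_tsum {F : ℕ} (φ : Fin F → ℕ → ℝ) (B₃ : ℕ)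
    (hφ : ∀ f, Summable fun k : ℕ ↦ φ f (B₃ + k) ^ 2) (N : ℕ) (u : Fin F → ℝ) :
    ∑ m ∈ Finset.Ico B₃ N, (∑ f, u f * φ f m) ^ 2
      ≤ ∑ f, ∑ f', u f * u f' * ∑' k : ℕ, φ f (B₃ + k) * φ f' (B₃ + k) := by
  set g : ℕ → ℝ := fun k ↦ (∑ f, u f * φ f (B₃ + k)) ^ 2 with hg
  have hg0 : ∀ k, 0 ≤ g k := fun k ↦ sq_nonneg _
  have hexp : ∀ k : ℕ, g k = ∑ f, ∑ f', u f * u f' * (φ f (B₃ + k) * φ f' (B₃ + k)) := by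
    intro k
    simp only [hg, sq, Finset.sum_mul_sum]
    exact Finset.sum_congr rfl fun f _ ↦ Finset.sum_congr rfl fun f' _ ↦ by ring
  have hsumm : ∀ f f' : Fin F, Summable fun k : ℕ ↦ u f * u f' * (φ f (B₃ + k) * φ f' (B₃ + k)) :=
    fun f f' ↦ (familyGram_summable_mul (hφ f) (hφ f')).mul_left _
  have hgs : Summable g := by
    have : Summable fun k : ℕ ↦ ∑ f, ∑ f', u f * u f' * (φ f (B₃ + k) * φ f' (B₃ + k)) :=
      summable_sum fun f _ ↦ summable_sum fun f' _ ↦ hsumm f f'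
    exact this.congr fun k ↦ (hexp k).symm
  have hIco : ∑ m ∈ Finset.Ico B₃ N, (∑ f, u f * φ f m) ^ 2 = ∑ k ∈ Finset.range (N - B₃), g k := by
    rw [Finset.sum_Ico_eq_sum_range]
  rw [hIco]
  calc ∑ k ∈ Finset.range (N - B₃), g k ≤ ∑' k, g k := hgs.sum_le_tsum _ fun k _ ↦ hg0 k
    _ = ∑' k : ℕ, ∑ f, ∑ f', u f * u f' * (φ f (B₃ + k) * φ f' (B₃ + k)) := tsum_congr hexp
    _ = ∑ f, ∑' k : ℕ, ∑ f', u f * u f' * (φ f (B₃ + k) * φ f' (B₃ + k)) :=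
        Summable.tsum_finsetSum fun f _ ↦ summable_sum fun f' _ ↦ hsumm f f'
    _ = ∑ f, ∑ f', ∑' k : ℕ, u f * u f' * (φ f (B₃ + k) * φ f' (B₃ + k)) :=
        Finset.sum_congr rfl fun f _ ↦ Summable.tsum_finsetSum fun f' _ ↦ hsumm f f'
    _ = ∑ f, ∑ f', u f * u f' * ∑' k : ℕ, φ f (B₃ + k) * φ f' (B₃ + k) :=
        Finset.sum_congr rfl fun f _ ↦ Finset.sum_congr rfl fun f' _ ↦ tsum_mul_left

/-- **The Gram majorant from entry boxes.**  If, in addition, `|Σ'_k φ_f(B₃+k)φ_{f'}(B₃+k) − Γmid(f,f')| ≤ ρ(f,f')` with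
`ρ` symmetric, then for positive weights `ν` and every `N`, `u`:
`Σ_{m∈Ico B₃ N} (Σ_f u_f φ_f(m))² ≤ Σ_f Σ_{f'} u_f u_{f'} Γmid(f,f') + Σ_f u_f² Σ_{f'} ρ(f,f') ν_{f'}/ν_f`
— the hypothesis `hΓ` of `coupling_majorant_gram` with an explicit quadratic form. -/
theorem sum_Ico_sq_sum_mul_le_of_boxes {F : ℕ} (φ : Fin F → ℕ → ℝ) (B₃ : ℕ)
    (hφ : ∀ f, Summable fun k : ℕ ↦ φ f (B₃ + k) ^ 2) (Γmid ρ : Fin F → Fin F → ℝ)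
    (hbox : ∀ f f', |(∑' k : ℕ, φ f (B₃ + k) * φ f' (B₃ + k)) - Γmid f f'| ≤ ρ f f')
    (hρ : ∀ f f', ρ f f' = ρ f' f) (ν : Fin F → ℝ) (hν : ∀ f, 0 < ν f) (N : ℕ) (u : Fin F → ℝ) :
    ∑ m ∈ Finset.Ico B₃ N, (∑ f, u f * φ f m) ^ 2
      ≤ (∑ f, ∑ f', u f * u f' * Γmid f f') + ∑ f, u f ^ 2 * ∑ f', ρ f f' * ν f' / ν f :=
  (sum_Ico_sq_sum_mul_le_gram_tsum φ B₃ hφ N u).trans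
    (gram_le_mid_add_gershgorin (fun f f' ↦ ∑' k : ℕ, φ f (B₃ + k) * φ f' (B₃ + k)) Γmid ρ ν u hν hbox hρ)

/-! ## Bookkeeping for the entry boxes -/

/-- **An entry = exact range + far tail**: for `B₃ ≤ B₄` and `h` summable on `[B₃, ∞)`,
`Σ'_k h(B₃+k) = Σ_{m∈Ico B₃ B₄} h(m) + Σ'_k h(B₄+k)`. -/
theorem tsum_shift_eq_sum_Ico_add_tsum_shift (h : ℕ → ℝ) {B₃ B₄ : ℕ} (hB : B₃ ≤ B₄)
    (hs : Summable fun k : ℕ ↦ h (B₃ + k)) :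
    ∑' k : ℕ, h (B₃ + k) = ∑ m ∈ Finset.Ico B₃ B₄, h m + ∑' k : ℕ, h (B₄ + k) := by
  rw [← hs.sum_add_tsum_nat_add (B₄ - B₃), Finset.sum_Ico_eq_sum_range]
  congr 1
  refine tsum_congr fun k ↦ ?_
  congr 1
  omega

/-- The far tail of a sequence summable on `[B₃, ∞)` is summable on `[B₄, ∞)` (`B₃ ≤ B₄`). -/
theorem summable_shift_of_le {h : ℕ → ℝ} {B₃ B₄ : ℕ} (hB : B₃ ≤ B₄) (hs : Summable fun k : ℕ ↦ h (B₃ + k)) :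
    Summable fun k : ℕ ↦ h (B₄ + k) := by
  have := (summable_nat_add_iff (f := fun k : ℕ ↦ h (B₃ + k)) (B₄ - B₃)).2 hs
  refine this.congr fun k ↦ ?_
  show h (B₃ + (k + (B₄ - B₃))) = h (B₄ + k)
  congr 1
  omega

/-- **Box of a sum**: `|S₁ − c₁| ≤ ρ₁`, `|S₂ − c₂| ≤ ρ₂` ⇒ `|(S₁ + S₂) − (c₁ + c₂)| ≤ ρ₁ + ρ₂`. -/
theorem abs_sub_add_le_of_boxes {S₁ S₂ c₁ c₂ ρ₁ ρ₂ : ℝ} (h₁ : |S₁ - c₁| ≤ ρ₁) (h₂ : |S₂ - c₂| ≤ ρ₂) :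
    |S₁ + S₂ - (c₁ + c₂)| ≤ ρ₁ + ρ₂ := by
  calc |S₁ + S₂ - (c₁ + c₂)| = |(S₁ - c₁) + (S₂ - c₂)| := by ring_nf
    _ ≤ |S₁ - c₁| + |S₂ - c₂| := abs_add_le _ _
    _ ≤ ρ₁ + ρ₂ := add_le_add h₁ h₂

/-- **Box of a scaled entry**: `|S − c| ≤ ρ` ⇒ `|aS − ac| ≤ |a|ρ`. -/
theorem abs_mul_sub_mul_le_of_box {S c ρ : ℝ} (a : ℝ) (h : |S - c| ≤ ρ) : |a * S - a * c| ≤ |a| * ρ := by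
  rw [← mul_sub, abs_mul]
  exact mul_le_mul_of_nonneg_left h (abs_nonneg _)

/-- **From `N`-uniform bounds on the partial sums to the infinite tail** (two-sided): if `|Σ_{m∈Ico M N} h(m)| ≤ D` for
every `N` and `h` is summable on `[M, ∞)`, then `|Σ'_k h(M+k)| ≤ D`. -/
theorem abs_tsum_shift_le_of_partial (h : ℕ → ℝ) (M : ℕ) (hs : Summable fun k : ℕ ↦ h (M + k)) {D : ℝ}
    (hD : ∀ N, |∑ m ∈ Finset.Ico M N, h m| ≤ D) : |∑' k : ℕ, h (M + k)| ≤ D := by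
  have ht : Tendsto (fun n ↦ ∑ k ∈ Finset.range n, h (M + k)) atTop (𝓝 (∑' k : ℕ, h (M + k))) :=
    hs.hasSum.tendsto_sum_nat
  have habs : Tendsto (fun n ↦ |∑ k ∈ Finset.range n, h (M + k)|) atTop (𝓝 |∑' k : ℕ, h (M + k)|) :=
    (continuous_abs.tendsto _).comp ht
  refine le_of_tendsto' habs fun n ↦ ?_
  have e : ∑ k ∈ Finset.range n, h (M + k) = ∑ m ∈ Finset.Ico M (M + n), h m := by
    rw [Finset.sum_Ico_eq_sum_range, Nat.add_sub_cancel_left]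
  rw [e]
  exact hD (M + n)

/-- **One-sided version**: if `Σ_{m∈Ico M N} h(m) ≤ D` for every `N` and `h` is summable on `[M, ∞)`, then
`Σ'_k h(M+k) ≤ D`. -/
theorem tsum_shift_le_of_partial (h : ℕ → ℝ) (M : ℕ) (hs : Summable fun k : ℕ ↦ h (M + k)) {D : ℝ}
    (hD : ∀ N, ∑ m ∈ Finset.Ico M N, h m ≤ D) : ∑' k : ℕ, h (M + k) ≤ D := by
  have ht : Tendsto (fun n ↦ ∑ k ∈ Finset.range n, h (M + k)) atTop (𝓝 (∑' k : ℕ, h (M + k))) :=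
    hs.hasSum.tendsto_sum_nat
  refine le_of_tendsto' ht fun n ↦ ?_
  have e : ∑ k ∈ Finset.range n, h (M + k) = ∑ m ∈ Finset.Ico M (M + n), h m := by
    rw [Finset.sum_Ico_eq_sum_range, Nat.add_sub_cancel_left]
  rw [e]
  exact hD (M + n)

/-- **Lower one-sided version**: if `D ≤ Σ_{m∈Ico M N} h(m)` for every `N ≥ N₀` and `h` is summable on `[M, ∞)`, then
`D ≤ Σ'_k h(M+k)`. -/
theorem le_tsum_shift_of_partial (h : ℕ → ℝ) (M : ℕ) (hs : Summable fun k : ℕ ↦ h (M + k)) {D : ℝ} (N₀ : ℕ)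
    (hD : ∀ N, N₀ ≤ N → D ≤ ∑ m ∈ Finset.Ico M N, h m) : D ≤ ∑' k : ℕ, h (M + k) := by
  have ht : Tendsto (fun n ↦ ∑ k ∈ Finset.range n, h (M + k)) atTop (𝓝 (∑' k : ℕ, h (M + k))) :=
    hs.hasSum.tendsto_sum_nat
  refine ge_of_tendsto ht ?_
  rw [Filter.eventually_atTop]
  refine ⟨N₀, fun n hn ↦ ?_⟩
  have e : ∑ k ∈ Finset.range n, h (M + k) = ∑ m ∈ Finset.Ico M (M + n), h m := by
    rw [Finset.sum_Ico_eq_sum_range, Nat.add_sub_cancel_left]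
  rw [e]
  exact hD (M + n) (by omega)

/-- **Partial sums of a nonnegative tail are below the infinite tail**: `h ≥ 0` on `[M, ∞)` and summable there ⇒
`Σ_{m∈Ico M N} h(m) ≤ Σ'_k h(M+k)` for every `N`. -/
theorem sum_Ico_le_tsum_shift (h : ℕ → ℝ) (M : ℕ) (hs : Summable fun k : ℕ ↦ h (M + k))
    (h0 : ∀ m, M ≤ m → 0 ≤ h m) (N : ℕ) : ∑ m ∈ Finset.Ico M N, h m ≤ ∑' k : ℕ, h (M + k) := by
  rw [Finset.sum_Ico_eq_sum_range]
  exact hs.sum_le_tsum _ fun k _ ↦ h0 (M + k) (by omega)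

/-- **A two-sided box from two one-sided `N`-uniform bounds**: `lo ≤ Σ_{m∈Ico M N} h ≤ hi` (`lo` for `N ≥ N₀`, `hi` for all
`N`) ⇒ `|Σ'_k h(M+k) − (hi+lo)/2| ≤ (hi−lo)/2`. -/
theorem abs_tsum_shift_sub_mid_le (h : ℕ → ℝ) (M : ℕ) (hs : Summable fun k : ℕ ↦ h (M + k)) {lo hi : ℝ} (N₀ : ℕ)
    (hlo : ∀ N, N₀ ≤ N → lo ≤ ∑ m ∈ Finset.Ico M N, h m) (hhi : ∀ N, ∑ m ∈ Finset.Ico M N, h m ≤ hi) :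
    |∑' k : ℕ, h (M + k) - (hi + lo) / 2| ≤ (hi - lo) / 2 := by
  have h1 := le_tsum_shift_of_partial h M hs N₀ hlo
  have h2 := tsum_shift_le_of_partial h M hs hhi
  rw [abs_le]
  constructor <;> linarith

end Summit.RiemannHypothesis.RiemannHypothesis.Theorems.WeilFormatC
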